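import Mathlib
import HarnessLib
import Summits.NavierStokesRegularity.NavierStokesRegularity.Theorems.PoloidalWindowDoorPoloidalWindowRigidityZShockSlopeFunctionLocal

/-!
# Crux K2 `PoloidalWindowRigidity` (stmt-NavierStokesRegularity-19708), line `z_shock` — L0(b) WITH REGULARITY: THE LOCAL SLOPE FUNCTION IS
# REAL-ANALYTIC

`--supports stmt-NavierStokesRegularity-19708 --as helper` (leafhand-ns-poloidalwindowdoor-2 g0, 2026-08-31).  Class-free; Mathlib + the
companion `…ZShockSlopeFunctionLocal` (whose `g` carries no regularity).  **No stub and no summit is closed by this file; Navier–Stokes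
regularity is NOT proved here.**

Why.  Every use the line makes of the autonomy clause `∂_z v_b = g(v₂)·∂_b v₂` downstream (rung R2 / the deciding stub's core R3: genuine
nonlinearity is `g_w ≠ 0`; the height-evolution `w_zz + Δₕ[𝑔(w)] = 0`, `𝑔' = g`) needs `g` DIFFERENTIABLE.  The functional-dependence
lemma of the companion produces SOME `g : ℝ → ℝ`; here, for real-analytic data (the slice IS real-analytic), the same construction yields
`g` real-analytic at the relevant values:

* `exists_analytic_comp_eq_of_fderiv_eq_smul` — `w, Λ` analytic at `y`, `Dw(y) e ≠ 0`, `DΛ ∥ Dw` near `y` ⇒ `Λ = g ∘ w` near `y` with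
  `g` ANALYTIC at `w y` (`g = Λ ∘ ψ ∘ (s ↦ Φ y + (s − w y)e)`, `ψ` the analytic local inverse of the straightening map,
  `OpenPartialHomeomorph.analyticAt_symm'`);
* `exists_analytic_slope_function_near` — quotient form `N = g(w)·D` near `y`, `g` analytic at `w y`;
* `exists_analytic_slope_function_near_of_analytic` — analytic slice `f : ℝ³ → ℝ³`, vanishing minors (L0(a)), `∂_b f₂(x) ≠ 0` ⇒ open
  `U ∋ x` and `g` with `∂_z f_b = g(f₂)·∂_b f₂` on `U` AND `g` analytic at every value `f₂(x')`, `x' ∈ U`.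

presearch: as for the companion (rank-one functional dependence; analytic inverse function theorem is Mathlib's). [folklore]
-/

noncomputable section

namespace Summit.NavierStokesRegularity.NavierStokesRegularity.Theorems.PoloidalWindowDoorPoloidalWindowRigidityZShockSlopeFunctionAnalytic

-- the problem directory repeats the summit name (`NavierStokesRegularity/NavierStokesRegularity`)
set_option linter.dupNamespace false

open Set Filter Topology Function Metric
open Summit.NavierStokesRegularity.NavierStokesRegularity.Theorems.PoloidalWindowDoorPoloidalWindowRigidityZShockSlopeLevelCurves
open Summit.NavierStokesRegularity.NavierStokesRegularity.Theorems.PoloidalWindowDoorPoloidalWindowRigidityZShockSlopeFunctionLocal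
open Summit.NavierStokesRegularity.NavierStokesRegularity.Theorems.PoloidalWindowDoorPoloidalWindowRigidityZShockAutonomyGlobal
open Summit.NavierStokesRegularity.NavierStokesRegularity.Theorems.PoloidalWindowDoorPoloidalWindowRigidityConstantShearMeans
  (fderiv_coord_apply)
open Summit.NavierStokesRegularity.NavierStokesRegularity.Theorems.PoloidalWindowDoorPoloidalWindowRigidityHorizontalSourceGauge
  (analyticOnNhd_fderiv_apply_coord)

variable {E : Type*} [NormedAddCommGroup E] [NormedSpace ℝ E]

/-- **Rank-one functional dependence with an ANALYTIC slope function.**  Let `E` be a complete real normed space, `w, Λ : E → ℝ`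
real-analytic at `y`, `Dw(y) e ≠ 0`, `Λ` differentiable near `y` with `DΛ(x) = c(x)·Dw(x)` near `y`.  Then `Λ = g ∘ w` near `y` for
some `g : ℝ → ℝ` which is real-analytic at `w y`. [folklore] -/
theorem exists_analytic_comp_eq_of_fderiv_eq_smul [CompleteSpace E] {Λ w : E → ℝ} {y e : E}
    (hwA : AnalyticAt ℝ w y) (hΛA : AnalyticAt ℝ Λ y) (he : fderiv ℝ w y e ≠ 0)
    (hΛ : ∀ᶠ x in 𝓝 y, DifferentiableAt ℝ Λ x)
    (hpar : ∀ᶠ x in 𝓝 y, ∃ c : ℝ, fderiv ℝ Λ x = c • fderiv ℝ w x) :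
    ∃ g : ℝ → ℝ, AnalyticAt ℝ g (w y) ∧ ∀ᶠ x in 𝓝 y, Λ x = g (w x) := by
  have hw : ContDiffAt ℝ 1 w y := hwA.contDiffAt
  -- `w` is `C¹` near `y` and `Dw(x) e ≠ 0` near `y`
  have hw1 : ∀ᶠ x in 𝓝 y, ContDiffAt ℝ 1 w x := hw.eventually (by simp)
  have hne : ∀ᶠ x in 𝓝 y, fderiv ℝ w x e ≠ 0 := by
    have hc : ContinuousAt (fun x => fderiv ℝ w x e) y :=
      ((ContinuousLinearMap.apply ℝ ℝ e).continuous.continuousAt).comp (hw.continuousAt_fderiv one_ne_zero)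
    exact hc.eventually_ne he
  -- the functional `ℓ` with `ℓ e = 1` and the straightening map `Φ`
  set a : ℝ := fderiv ℝ w y e with ha
  set ℓ : E →L[ℝ] ℝ := a⁻¹ • fderiv ℝ w y with hℓdef
  have hℓ : ℓ e = 1 := by
    simp only [hℓdef, _root_.smul_apply, smul_eq_mul, ← ha]
    exact inv_mul_cancel₀ he
  set Φ : E → E := fun x => x + (w x - ℓ x) • e with hΦdef
  have hΦw : ∀ x, ℓ (Φ x) = w x := by
    intro x
    simp only [hΦdef, map_add, map_smul, smul_eq_mul, hℓ]
    ring
  have hΦd : ∀ x, DifferentiableAt ℝ w x →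
      HasFDerivAt Φ (ContinuousLinearMap.id ℝ E + (fderiv ℝ w x - ℓ).smulRight e) x := by
    intro x hx
    exact (hasFDerivAt_id x).add ((hx.hasFDerivAt.sub ℓ.hasFDerivAt).smul_const e)
  obtain ⟨L, hL⟩ := exists_shearEquiv (fderiv ℝ w y) ℓ e he hℓ
  have hΦy : HasFDerivAt Φ (L : E →L[ℝ] E) y := by
    rw [hL]; exact hΦd y (hw.differentiableAt one_ne_zero)
  have hΦc : ContDiffAt ℝ 1 Φ y :=
    contDiffAt_id.add ((hw.sub ℓ.contDiff.contDiffAt).smul contDiffAt_const)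
  -- the local inverse `ψ = φ.symm`
  set φ := hΦc.toOpenPartialHomeomorph Φ hΦy one_ne_zero with hφdef
  have hφ : (φ : E → E) = Φ := hΦc.toOpenPartialHomeomorph_coe hΦy one_ne_zero
  have hyS : y ∈ φ.source := hΦc.mem_toOpenPartialHomeomorph_source hΦy one_ne_zero
  -- the good neighbourhood `V` of `y` and the open set `T' = target ∩ ψ⁻¹ V ∋ Φ y`
  obtain ⟨V, hVsub, hVopen, hyV⟩ := _root_.mem_nhds_iff.1 (hw1.and (hne.and (hΛ.and hpar)))
  set T' : Set E := φ.target ∩ φ.symm ⁻¹' V with hT'def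
  have hT'open : IsOpen T' := φ.isOpen_inter_preimage_symm hVopen
  have hyΦ : φ.symm (Φ y) = y := by rw [← hφ]; exact φ.left_inv hyS
  have hq₀T' : Φ y ∈ T' := by
    refine ⟨?_, ?_⟩
    · rw [← hφ]; exact φ.map_source hyS
    · show φ.symm (Φ y) ∈ V
      rw [hyΦ]; exact hyV
  obtain ⟨r, hr, hball⟩ := Metric.isOpen_iff.1 hT'open (Φ y) hq₀T'
  -- derivative of `ψ` on `T'`, and `Dw(ψ q)[Dψ(q) d] = ℓ d`
  have hderivψ : ∀ q ∈ T', ∃ M : E →L[ℝ] E, HasFDerivAt φ.symm M q ∧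
      ∀ d, fderiv ℝ w (φ.symm q) (M d) = ℓ d := by
    intro q hq
    have hx := hVsub hq.2
    obtain ⟨Lx, hLx⟩ := exists_shearEquiv (fderiv ℝ w (φ.symm q)) ℓ e hx.2.1 hℓ
    have hΦx : HasFDerivAt φ (Lx : E →L[ℝ] E) (φ.symm q) := by
      rw [hφ, hLx]; exact hΦd _ (hx.1.differentiableAt one_ne_zero)
    refine ⟨(Lx.symm : E →L[ℝ] E), φ.hasFDerivAt_symm hq.1 hΦx, fun d => ?_⟩
    have key : ∀ h, ℓ (Lx h) = fderiv ℝ w (φ.symm q) h := by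
      intro h
      rw [show Lx h = (Lx : E →L[ℝ] E) h from rfl, hLx]
      rw [shear_apply, map_add, map_smul, hℓ, smul_eq_mul, mul_one]
      ring
    have h := key (Lx.symm d)
    rw [ContinuousLinearEquiv.apply_symm_apply] at h
    exact h.symm
  -- `Λ ∘ ψ` is constant on the slices `{ℓ = s}` of the ball
  have hconst : ∀ q q', q ∈ ball (Φ y) r → q' ∈ ball (Φ y) r → ℓ q = ℓ q' →
      Λ (φ.symm q') = Λ (φ.symm q) := by
    intro q q' hq hq' hℓqq'
    set d : E := q' - q with hd_def
    have hd : ℓ d = 0 := by simp [hd_def, hℓqq']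
    have hseg : ∀ t ∈ Icc (0 : ℝ) 1, q + t • d ∈ ball (Φ y) r := by
      intro t ht
      have h := (convex_ball (Φ y) r).add_smul_sub_mem hq hq' ht
      simpa [hd_def] using h
    have hG : ∀ t ∈ Icc (0 : ℝ) 1, HasDerivAt (fun s : ℝ => Λ (φ.symm (q + s • d))) 0 t := by
      intro t ht
      have hqT' : q + t • d ∈ T' := hball (hseg t ht)
      obtain ⟨M, hM, hMw⟩ := hderivψ _ hqT'
      have hx := hVsub hqT'.2
      obtain ⟨c, hc⟩ := hx.2.2.2
      have h1 : HasDerivAt (fun s : ℝ => q + s • d) d t := by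
        simpa using ((hasDerivAt_id t).smul_const d).const_add q
      have h2 : HasDerivAt (fun s : ℝ => φ.symm (q + s • d)) (M d) t := hM.comp_hasDerivAt t h1
      have h3 : HasDerivAt (fun s : ℝ => Λ (φ.symm (q + s • d)))
          (fderiv ℝ Λ (φ.symm (q + t • d)) (M d)) t :=
        hx.2.2.1.hasFDerivAt.comp_hasDerivAt t h2
      have h4 : fderiv ℝ Λ (φ.symm (q + t • d)) (M d) = 0 := by
        rw [hc, _root_.smul_apply, hMw, hd, smul_zero]
      rwa [h4] at h3
    have h := constant_of_has_deriv_right_zero (f := fun s : ℝ => Λ (φ.symm (q + s • d))) (a := 0) (b := 1)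
      (fun t ht => (hG t ht).continuousAt.continuousWithinAt)
      (fun t ht => (hG t (Ico_subset_Icc_self ht)).hasDerivWithinAt) 1 (right_mem_Icc.2 zero_le_one)
    simpa [hd_def] using h
  -- conclusion: the slope function and its analyticity
  refine ⟨fun s => Λ (φ.symm (Φ y + (s - w y) • e)), ?_, ?_⟩
  · -- `g = Λ ∘ ψ ∘ (s ↦ Φ y + (s - w y)•e)` is analytic at `w y`
    have hΦA : AnalyticAt ℝ Φ y := analyticAt_id.add ((hwA.sub (ℓ.analyticAt y)).smul analyticAt_const)
    have hΦA' : AnalyticAt ℝ φ y := by rw [hφ]; exact hΦA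
    have hfd : fderiv ℝ φ y = (L : E →L[ℝ] E) := by rw [hφ]; exact hΦy.fderiv
    have hψA : AnalyticAt ℝ φ.symm (φ y) := φ.analyticAt_symm' hyS hΦA' hfd
    have hψA' : AnalyticAt ℝ φ.symm (Φ y) := by rw [← hφ]; exact hψA
    have hΛA' : AnalyticAt ℝ Λ (φ.symm (Φ y)) := by rw [hyΦ]; exact hΛA
    have haff : AnalyticAt ℝ (fun s : ℝ => Φ y + (s - w y) • e) (w y) :=
      analyticAt_const.add ((analyticAt_id.sub analyticAt_const).smul analyticAt_const)
    have h0 : (fun s : ℝ => Φ y + (s - w y) • e) (w y) = Φ y := by simp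
    have h1 : AnalyticAt ℝ (fun s : ℝ => φ.symm (Φ y + (s - w y) • e)) (w y) := hψA'.comp_of_eq haff h0
    have h2 : φ.symm ((fun s : ℝ => Φ y + (s - w y) • e) (w y)) = φ.symm (Φ y) := by rw [h0]
    exact hΛA'.comp_of_eq h1 h2
  have h1 : ∀ᶠ x in 𝓝 y, Φ x ∈ ball (Φ y) r := hΦy.continuousAt.preimage_mem_nhds (ball_mem_nhds _ hr)
  have h2 : ∀ᶠ x in 𝓝 y, Φ y + (w x - w y) • e ∈ ball (Φ y) r := by
    have hc : ContinuousAt (fun x => Φ y + (w x - w y) • e) y :=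
      continuousAt_const.add ((hw.continuousAt.sub continuousAt_const).smul continuousAt_const)
    have h0 : Φ y + (w y - w y) • e = Φ y := by simp
    refine hc.preimage_mem_nhds ?_
    rw [h0]
    exact ball_mem_nhds _ hr
  have h3 : ∀ᶠ x in 𝓝 y, x ∈ φ.source := φ.open_source.mem_nhds hyS
  filter_upwards [h1, h2, h3] with x hx1 hx2 hx3
  have hℓeq : ℓ (Φ x) = ℓ (Φ y + (w x - w y) • e) := by
    rw [hΦw, map_add, hΦw, map_smul, hℓ, smul_eq_mul, mul_one]
    ring
  have h := hconst _ _ hx1 hx2 hℓeq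
  have hxΦ : φ.symm (Φ x) = x := by rw [← hφ]; exact φ.left_inv hx3
  rw [hxΦ] at h
  exact h.symm


/-- **Quotient form with an analytic slope function.**  `w, N, D` analytic at `y`, `N, D` differentiable near `y`, `D = Dw(·) e`
near `y`, `D y ≠ 0`, minors of `(D·∇N − N·∇D, ∇w)` vanish near `y` ⇒ `N = g(w)·D` near `y` with `g` analytic at `w y`. [folklore] -/
theorem exists_analytic_slope_function_near [CompleteSpace E] {N D w : E → ℝ} {y e : E}
    (hwA : AnalyticAt ℝ w y) (hNA : AnalyticAt ℝ N y) (hDA : AnalyticAt ℝ D y)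
    (hN : ∀ᶠ x in 𝓝 y, DifferentiableAt ℝ N x) (hD : ∀ᶠ x in 𝓝 y, DifferentiableAt ℝ D x)
    (hDw : ∀ᶠ x in 𝓝 y, D x = fderiv ℝ w x e) (hDy : D y ≠ 0)
    (hminor : ∀ᶠ x in 𝓝 y, ∀ u v : E,
      (D x * fderiv ℝ N x u - N x * fderiv ℝ D x u) * fderiv ℝ w x v -
        (D x * fderiv ℝ N x v - N x * fderiv ℝ D x v) * fderiv ℝ w x u = 0) :
    ∃ g : ℝ → ℝ, AnalyticAt ℝ g (w y) ∧ ∀ᶠ x in 𝓝 y, N x = g (w x) * D x := by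
  have hw : ContDiffAt ℝ 1 w y := hwA.contDiffAt
  have hDne : ∀ᶠ x in 𝓝 y, D x ≠ 0 := hD.self_of_nhds.continuousAt.eventually_ne hDy
  have he : fderiv ℝ w y e ≠ 0 := by rw [← hDw.self_of_nhds]; exact hDy
  have hne : ∀ᶠ x in 𝓝 y, fderiv ℝ w x e ≠ 0 :=
    (((ContinuousLinearMap.apply ℝ ℝ e).continuous.continuousAt).comp
      (hw.continuousAt_fderiv one_ne_zero)).eventually_ne he
  -- the slope and its differentiability / analyticity
  set Λ : E → ℝ := fun x => N x * (D x)⁻¹ with hΛdef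
  have hΛA : AnalyticAt ℝ Λ y := hNA.mul (hDA.inv hDy)
  obtain ⟨V, hVsub, hVopen, hyV⟩ := _root_.mem_nhds_iff.1 (hN.and (hD.and (hDne.and (hminor.and hDw))))
  have hΛV : ∀ x ∈ V, HasFDerivAt Λ
      (N x • ((ContinuousLinearMap.toSpanSingleton ℝ (-(D x ^ 2)⁻¹)).comp (fderiv ℝ D x)) +
        (D x)⁻¹ • fderiv ℝ N x) x := by
    intro x hx
    have h := hVsub hx
    have hinv : HasFDerivAt (fun z => (D z)⁻¹)
        ((ContinuousLinearMap.toSpanSingleton ℝ (-(D x ^ 2)⁻¹)).comp (fderiv ℝ D x)) x :=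
      (hasFDerivAt_inv h.2.2.1).comp x h.2.1.hasFDerivAt
    exact h.1.hasFDerivAt.mul hinv
  have hΛ : ∀ᶠ x in 𝓝 y, DifferentiableAt ℝ Λ x := by
    filter_upwards [hVopen.mem_nhds hyV] with x hx
    exact (hΛV x hx).differentiableAt
  have hΛpar : ∀ᶠ x in 𝓝 y, ∃ c : ℝ, fderiv ℝ Λ x = c • fderiv ℝ w x := by
    filter_upwards [hVopen.mem_nhds hyV, hne] with x hx hxe
    have h := hVsub hx
    have hDx : D x ≠ 0 := h.2.2.1
    have hfd : ∀ u, D x ^ 2 * fderiv ℝ Λ x u = D x * fderiv ℝ N x u - N x * fderiv ℝ D x u := by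
      intro u
      rw [(hΛV x hx).fderiv]
      simp only [_root_.add_apply, _root_.smul_apply, smul_eq_mul, ContinuousLinearMap.comp_apply,
        ContinuousLinearMap.toSpanSingleton_apply]
      field_simp
      ring
    have hmin : ∀ u v : E, fderiv ℝ Λ x u * fderiv ℝ w x v - fderiv ℝ Λ x v * fderiv ℝ w x u = 0 := by
      intro u v
      have hm := h.2.2.2.1 u v
      have hD2 : D x ^ 2 ≠ 0 := pow_ne_zero 2 hDx
      have key : D x ^ 2 * (fderiv ℝ Λ x u * fderiv ℝ w x v - fderiv ℝ Λ x v * fderiv ℝ w x u) = 0 := by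
        have : D x ^ 2 * (fderiv ℝ Λ x u * fderiv ℝ w x v - fderiv ℝ Λ x v * fderiv ℝ w x u) =
            (D x ^ 2 * fderiv ℝ Λ x u) * fderiv ℝ w x v - (D x ^ 2 * fderiv ℝ Λ x v) * fderiv ℝ w x u := by ring
        rw [this, hfd u, hfd v]
        exact hm
      rcases mul_eq_zero.1 key with h0 | h0
      · exact absurd h0 hD2
      · exact h0
    exact ⟨_, eq_smul_of_minors_eq_zero hxe hmin⟩
  obtain ⟨g, hgA, hg⟩ := exists_analytic_comp_eq_of_fderiv_eq_smul hwA hΛA he hΛ hΛpar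
  refine ⟨g, hgA, ?_⟩
  filter_upwards [hg, hDne] with x hx hDx
  rw [← hx, hΛdef]
  simp only
  rw [inv_mul_cancel_right₀ hDx]

/-- **L0(b) local form with an analytic slope function, for an analytic slice.**  `f : ℝ³ → ℝ³` real-analytic, `b : Fin 3`, minors of
`(∂_b f₂·∇(∂_z f_b) − ∂_z f_b·∇(∂_b f₂), ∇f₂)` vanish everywhere (L0(a)), `∂_b f₂(x) ≠ 0` ⇒ an open `U ∋ x` and `g : ℝ → ℝ`, ANALYTIC
at every value `f₂(x')`, `x' ∈ U`, with `∂_z f_b = g(f₂)·∂_b f₂` on `U`. [folklore] -/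
theorem exists_analytic_slope_function_near_of_analytic {f : EuclideanSpace ℝ (Fin 3) → EuclideanSpace ℝ (Fin 3)}
    (hf : AnalyticOnNhd ℝ f univ) {b : Fin 3}
    (hminor : ∀ x u u' : EuclideanSpace ℝ (Fin 3),
      (fderiv ℝ f x (EuclideanSpace.single b 1) 2 *
            fderiv ℝ (fun y => fderiv ℝ f y (EuclideanSpace.single 2 1) b) x u -
          fderiv ℝ f x (EuclideanSpace.single 2 1) b *
            fderiv ℝ (fun y => fderiv ℝ f y (EuclideanSpace.single b 1) 2) x u) *
          fderiv ℝ (fun y => f y 2) x u' -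
        (fderiv ℝ f x (EuclideanSpace.single b 1) 2 *
            fderiv ℝ (fun y => fderiv ℝ f y (EuclideanSpace.single 2 1) b) x u' -
          fderiv ℝ f x (EuclideanSpace.single 2 1) b *
            fderiv ℝ (fun y => fderiv ℝ f y (EuclideanSpace.single b 1) 2) x u') *
          fderiv ℝ (fun y => f y 2) x u = 0)
    {x : EuclideanSpace ℝ (Fin 3)} (hx : fderiv ℝ f x (EuclideanSpace.single b 1) 2 ≠ 0) :
    ∃ g : ℝ → ℝ, ∃ U : Set (EuclideanSpace ℝ (Fin 3)), IsOpen U ∧ x ∈ U ∧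
      (∀ x' ∈ U, AnalyticAt ℝ g (f x' 2)) ∧
      ∀ x' ∈ U, fderiv ℝ f x' (EuclideanSpace.single 2 1) b =
        g (f x' 2) * fderiv ℝ f x' (EuclideanSpace.single b 1) 2 := by
  set N : EuclideanSpace ℝ (Fin 3) → ℝ := fun y => fderiv ℝ f y (EuclideanSpace.single 2 1) b with hNdef
  set D : EuclideanSpace ℝ (Fin 3) → ℝ := fun y => fderiv ℝ f y (EuclideanSpace.single b 1) 2 with hDdef
  set w : EuclideanSpace ℝ (Fin 3) → ℝ := fun y => f y 2 with hwdef
  have hN : AnalyticOnNhd ℝ N univ := analyticOnNhd_fderiv_apply_coord hf _ _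
  have hD : AnalyticOnNhd ℝ D univ := analyticOnNhd_fderiv_apply_coord hf _ _
  have hw : AnalyticOnNhd ℝ w univ := analyticOnNhd_coord hf 2
  have hDw : ∀ y, D y = fderiv ℝ w y (EuclideanSpace.single b 1) := by
    intro y
    simp only [hwdef, hDdef, fderiv_coord_apply (hf y (mem_univ _)).differentiableAt]
  obtain ⟨g, hgA, hg⟩ := exists_analytic_slope_function_near (N := N) (D := D) (e := EuclideanSpace.single b 1)
    (hw x (mem_univ _)) (hN x (mem_univ _)) (hD x (mem_univ _))
    (Eventually.of_forall fun y => (hN y (mem_univ _)).differentiableAt)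
    (Eventually.of_forall fun y => (hD y (mem_univ _)).differentiableAt)
    (Eventually.of_forall hDw) hx (Eventually.of_forall fun y u v => hminor y u v)
  -- analyticity of `g` on a neighbourhood of `w x`, pulled back by the continuous `w`
  have hgA' : ∀ᶠ x' in 𝓝 x, AnalyticAt ℝ g (w x') :=
    (hw x (mem_univ _)).continuousAt.eventually hgA.eventually_analyticAt
  obtain ⟨U, hUsub, hUopen, hxU⟩ := _root_.mem_nhds_iff.1 (hg.and hgA')
  exact ⟨g, U, hUopen, hxU, fun x' hx' => (hUsub hx').2, fun x' hx' => (hUsub hx').1⟩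

end Summit.NavierStokesRegularity.NavierStokesRegularity.Theorems.PoloidalWindowDoorPoloidalWindowRigidityZShockSlopeFunctionAnalytic

end
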